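import Literature.Computability.Complexity.MoebiusBoundedDepthProofs
import Literature.Computability.Complexity.WalshDyadicFourier
import Literature.NumberTheory.LFunctions.MoebiusWalshDyadic
import Literature.NumberTheory.LFunctions.MoebiusDyadicModuli
import Literature.NumberTheory.Sieve.MoebiusExpSum
import HarnessLib

/-!
# Green 2012, Proposition 1 for `μ` (the Walsh–Fourier coefficients of the Möbius function), proved

Topic `Literature/Computability/Complexity`. Everything in this file is PROVED (theorems only, no
definition, no named fact); it discharges the named fact
`Literature.Computability.Complexity.Green2012_moebius_walshCoeff` of `MoebiusBoundedDepth.lean`: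

> B. Green, *On (not) computing the Möbius function using bounded depth circuits*, Combin. Probab.
> Comput. 21 (2012) 942–951 (= arXiv:1103.4991), **Proposition 1**: "Suppose that `S ⊆ {1,…,n}`
> has size `|S| = k`. Then `μ̂(S) = O(k e^{-cn^{1/2}/k})`, where `c > 0` is some absolute constant."

## The printed proof (§§3–4 of the paper) and its inputs in the tree

Suppose `|μ̂(S)| ≥ δ := Ck e^{-c√n/k}`.
* **Proposition 2** (Kátai; tree: `Literature.Computability.Complexity.WalshDyadic.exists_sparse_dyadic_of_le_abs_cubeFourierCoeff`,
  `WalshDyadicFourier.lean`): there is a sparse dyadic rational `θ = Σ_{i∈S} r_i/2^{i+1}`,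
  `|r_i| < R` (any `R ≥ 4k(n+1)/δ`), with `|Σ_{x<N} μ(x)e(θx)| ≥ δN/(2(2R)^k)`.
* **Proposition 3** (`Green2012Walsh.prop3` below): for `θ` sparse dyadic with `|r_i| ≤ e^{c₁√log N}`
  (and `k` small against `√n`), `|Σ_{x<N} μ(x)e(θx)| < e^{-c₁√log N} N`. Proof as printed: if not,
  **Proposition 4** (the minor-arc bound inverted; tree:
  `Literature.NumberTheory.Sieve.MoebiusExpSum.exists_rat_near_of_le_norm_afExpSum`,
  `MoebiusExpSum.lean`) puts `θ` within `Q/N` of some `a/q`, `q ≤ Q = C((1 + log N)/δ)^{40}`;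
  **Lemma 1** (Harman–Kátai; tree: `Literature.NumberTheory.LFunctions.twoPower_of_sparseDyadic_near`,
  `MoebiusWalshDyadic.lean`) forces `q = 2^t`; and **Corollary 2** of Theorem 3 (Möbius in
  progressions to 2-power moduli up to `e^{c√log N}`; tree:
  `Literature.NumberTheory.LFunctions.MoebiusDyadic.norm_afExpSum_moebius_near_twoPow_le`,
  `MoebiusDyadicModuli.lean`) bounds the sum by `C N e^{-c₄√log N}`, a contradiction for `c₁ < c₄`.
* The two propositions are incompatible once `c`, `C` are chosen suitably
  (`Green2012_moebius_walshCoeff_holds`); the regime where `Ck e^{-c√n/k} ≥ 1` is trivial since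
  `|μ̂(S)| ≤ 1`, and this regime contains every `k ≫ √n/log n` and every small `n`.
Constants differ from Green's (who does not compute them either); the statement proved is exactly
the vendored one (our `R` depends on `n`, which costs a harmless `log n = 2 log(kρ/c)` in the
bookkeeping). The `LFunctions` twin `green_moebius_fourierWalsh` follows by the proved bridge
`Green2012_moebius_walshCoeff_iff` (`MoebiusBoundedDepthProofs.lean`).

## References
* [Green2012] B. Green, Combin. Probab. Comput. 21 (2012) 942–951, Propositions 1–4, Lemma 1,
  Theorem 3 and Corollaries 1–2.
-/

noncomputable section

open Finset Real
open scoped FourierTransform ArithmeticFunction.Moebius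

namespace Literature.Computability.Complexity

namespace Green2012Walsh

open Literature.NumberTheory.LFunctions (walshSum twoPower_of_sparseDyadic_near)
open Literature.Computability.Complexity.WalshDyadic (exists_sparse_dyadic_of_le_abs_cubeFourierCoeff)
open Literature.NumberTheory.Sieve.Vinogradov (afExpSum)
open Literature.Probability.RandomGraphs.LowDegree (walsh sgn)
open Literature.Computability.Complexity.LowDegree (cubeFourierCoeff)

/-! ### Conversions between the vocabularies -/

/-- `μ(2^n) = 0` for `n ≥ 2`. [folklore] -/
theorem moebius_two_pow_eq_zero {n : ℕ} (hn : 2 ≤ n) : μ (2 ^ n) = 0 := by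
  refine ArithmeticFunction.moebius_eq_zero_of_not_squarefree fun h => ?_
  have := ((Nat.squarefree_pow_iff (by norm_num) (by omega)).1 h).2
  omega

/-- For `N = 2^n`, `n ≥ 2`, the sum `Σ_{x<N} μ(x)e(θx)` of `MoebiusWalshKatai` is the sum
`Σ_{1≤x≤N} μ(x)e(xθ)` of the circle-method files (`μ(0) = μ(2^n) = 0`). [folklore] -/
theorem sum_range_moebius_eq_afExpSum {n : ℕ} (hn : 2 ≤ n) (θ : ℝ) :
    ∑ x ∈ range (2 ^ n), (((μ x : ℤ) : ℝ) : ℂ) * (𝐞 (θ * x) : ℂ) =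
      afExpSum (fun m => (μ m : ℝ)) (2 ^ n) θ := by
  unfold afExpSum
  have hN : 1 ≤ 2 ^ n := Nat.one_le_two_pow
  have h1 : range (2 ^ n) = insert 0 (Ioo 0 (2 ^ n)) := by
    ext x; simp only [mem_range, mem_insert, mem_Ioo]; omega
  have h2 : Icc 1 (2 ^ n) = insert (2 ^ n) (Ioo 0 (2 ^ n)) := by
    ext x; simp only [mem_Icc, mem_insert, mem_Ioo]; omega
  rw [h1, h2, sum_insert (by simp), sum_insert (by simp)]
  dsimp only
  rw [moebius_two_pow_eq_zero hn, ArithmeticFunction.map_zero]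
  simp only [Int.cast_zero, Complex.ofReal_zero, zero_mul, zero_add]
  exact Finset.sum_congr rfl fun x _ => by rw [mul_comm θ]

/-- Reduction of a fraction to lowest terms: `a₀/q₀ = a/q` with `(a, q) = 1`, `1 ≤ q ≤ q₀`.
[folklore] -/
theorem exists_coprime_eq_div (a₀ : ℤ) {q₀ : ℕ} (hq₀ : 1 ≤ q₀) :
    ∃ q : ℕ, ∃ a : ℤ, 1 ≤ q ∧ q ≤ q₀ ∧ Int.gcd a q = 1 ∧ (a : ℝ) / q = a₀ / q₀ := by
  set r : ℚ := Rat.divInt a₀ q₀ with hr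
  refine ⟨r.den, r.num, r.den_pos, ?_, ?_, ?_⟩
  · have h := Rat.den_dvd a₀ q₀
    have h' : r.den ∣ q₀ := by exact_mod_cast h
    exact Nat.le_of_dvd (by omega) h'
  · rw [Int.gcd_eq_natAbs, Int.natAbs_natCast]
    exact r.reduced
  · have h1 : ((r : ℚ) : ℝ) = (r.num : ℝ) / r.den := Rat.cast_def r
    rw [← h1, hr, Rat.divInt_eq_div]
    push_cast
    rfl

/-! ### Green's Proposition 3: Möbius exponential sums at sparse dyadic rationals -/

/-- `(1 + L)^{40} ≤ e^{(c/5)√L}` once `L^{1/4} ≥ 1000/c` (`L ≥ 1`, `0 < c`), via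
`log L ≤ 4 L^{1/4}`. [folklore] -/
theorem one_add_pow_forty_le_exp {c L : ℝ} (hc : 0 < c) (hc1 : c ≤ 1) (hL : 1 ≤ L)
    (hT : (1000 / c) ^ 2 ≤ Real.sqrt L) :
    (1 + L) ^ (40 : ℕ) ≤ Real.exp (c / 5 * Real.sqrt L) := by
  have hL0 : 0 < L := by linarith
  set u : ℝ := Real.sqrt L with hu
  have hu0 : 0 ≤ u := Real.sqrt_nonneg L
  have hu2 : u ^ 2 = L := Real.sq_sqrt hL0.le
  set v : ℝ := Real.sqrt u with hv
  have hv0 : 0 ≤ v := Real.sqrt_nonneg u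
  have hv2 : v ^ 2 = u := Real.sq_sqrt hu0
  have hvT : 1000 / c ≤ v := by
    rw [hv, Real.le_sqrt (by positivity) hu0]; exact hT
  have hv1 : 1 ≤ v := by
    have : (1 : ℝ) ≤ 1000 / c := by
      rw [le_div_iff₀ hc]; linarith
    linarith
  have hlogL : Real.log L ≤ 4 * v := by
    have h := Literature.NumberTheory.LFunctions.MoebiusTwist.log_le_four_mul_sqrt_sqrt hL
    rw [← hu, ← hv] at h; exact h
  have hlog1L : Real.log (1 + L) ≤ 1 + 4 * v := by
    have h1 : Real.log (1 + L) ≤ Real.log (2 * L) := Real.log_le_log (by positivity) (by linarith)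
    rw [Real.log_mul two_ne_zero hL0.ne'] at h1
    have h2 : Real.log 2 ≤ 1 := by have := Real.log_two_lt_d9; linarith
    linarith
  -- `40 (1 + 4v) ≤ 200 v ≤ (c/5) v² = (c/5) u`
  have hkey : 40 * (1 + 4 * v) ≤ c / 5 * u := by
    rw [← hv2]
    have h1 : c / 5 * (1000 / c) = 200 := by field_simp; ring
    have h2 : 200 * v ≤ c / 5 * v ^ 2 := by
      calc 200 * v = c / 5 * (1000 / c) * v := by rw [h1]
        _ ≤ c / 5 * v * v := by
            have := mul_le_mul_of_nonneg_left hvT (by positivity : 0 ≤ c / 5 * v)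
            nlinarith
        _ = c / 5 * v ^ 2 := by ring
    nlinarith
  have hpos : 0 < 1 + L := by linarith
  calc (1 + L) ^ (40 : ℕ) = Real.exp (40 * Real.log (1 + L)) := by
        rw [← Real.exp_log (pow_pos hpos 40), Real.log_pow]; norm_num
    _ ≤ Real.exp (c / 5 * u) := Real.exp_le_exp.2 (by nlinarith)

/-- The enumeration of `S` by `Fin |S|`, shifted by one, is injective. [folklore] -/
theorem injective_enum_succ {n : ℕ} (S : Finset (Fin n)) :
    Function.Injective (fun j : Fin S.card => (((S.equivFin.symm j : S) : Fin n) : ℕ) + 1) := by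
  intro j j' h
  have h1 : (((S.equivFin.symm j : S) : Fin n) : ℕ) = (((S.equivFin.symm j' : S) : Fin n) : ℕ) := by
    simpa using h
  have h2 : ((S.equivFin.symm j : S) : Fin n) = ((S.equivFin.symm j' : S) : Fin n) := Fin.ext h1
  have h3 : (S.equivFin.symm j : S) = (S.equivFin.symm j' : S) := Subtype.ext h2
  exact S.equivFin.symm.injective h3

/-- Re-indexing a sum over `S` by the enumeration of `S`. [folklore] -/
theorem sum_enum_eq {n : ℕ} (S : Finset (Fin n)) (F : Fin n → ℝ) :
    ∑ j : Fin S.card, F ((S.equivFin.symm j : S) : Fin n) = ∑ i ∈ S, F i := by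
  rw [Equiv.sum_comp S.equivFin.symm (fun s : S => F (s : Fin n)), Finset.sum_coe_sort S F]

set_option maxHeartbeats 800000 in
/-- **Green 2012, Proposition 3** (exponential sums over Möbius at sparse dyadic rationals, in
the explicit form used below): there are `c₁ > 0` and a threshold `T` such that for all `n ≥ 2`
with `√(log 2ⁿ) ≥ T`, all nonempty `S ⊆ {0,…,n−1}` with `4e^{2√(log 2ⁿ)} < 2^{⌊n/(|S|+1)⌋}`
(this holds when `|S| ≤ c√n`, cf. Green's hypothesis `k < n^{1/2}` and Lemma 1's
`2^{n/2k} > 4Q²`), and all integer vectors `r` supported on `S` with `|r_i| ≤ e^{c₁√(log 2ⁿ)}`: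
`‖Σ_{x<2ⁿ} μ(x) e(θx)‖ < e^{−c₁√(log 2ⁿ)} 2ⁿ` for `θ = Σ_{i∈S} r_i/2^{i+1}`. Proof as printed
(Prop. 4 ⇒ `θ` near `a/q`, `q` small; Lemma 1 ⇒ `q = 2^t`; Corollary 2 ⇒ contradiction).
[cite: Green2012, §3 Proposition 3 and §4 (its proof)] -/
theorem prop3 :
    ∃ c₁ : ℝ, 0 < c₁ ∧ c₁ ≤ 1 ∧ ∃ T : ℝ, ∀ n : ℕ, 2 ≤ n →
      T ≤ Real.sqrt (Real.log ((2 : ℝ) ^ n)) →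
      ∀ S : Finset (Fin n), S.Nonempty →
        4 * Real.exp (2 * Real.sqrt (Real.log ((2 : ℝ) ^ n))) < (2 : ℝ) ^ (n / (S.card + 1)) →
        ∀ r : Fin n → ℤ,
          (∀ i, |(r i : ℝ)| ≤ Real.exp (c₁ * Real.sqrt (Real.log ((2 : ℝ) ^ n)))) →
          ‖∑ x ∈ range (2 ^ n), (((μ x : ℤ) : ℝ) : ℂ) *
              (𝐞 ((∑ j ∈ S, (r j : ℝ) / 2 ^ ((j : ℕ) + 1)) * x) : ℂ)‖ <
            Real.exp (-(c₁ * Real.sqrt (Real.log ((2 : ℝ) ^ n)))) * 2 ^ n := by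
  obtain ⟨c₄, hc₄, hc₄1, C₄, hC₄0, hB⟩ :=
    Literature.NumberTheory.LFunctions.MoebiusDyadic.norm_afExpSum_moebius_near_twoPow_le
  obtain ⟨CI, hCI, hC⟩ :=
    Literature.NumberTheory.Sieve.MoebiusExpSum.exists_rat_near_of_le_norm_afExpSum
  set c₁ : ℝ := c₄ / 200 with hc₁def
  have hc₁ : 0 < c₁ := by positivity
  set T : ℝ := max (max ((1000 / c₄) ^ 2) (5 * Real.log (CI + 1) / c₄))
    (max (2 * Real.log (C₄ + 1) / c₄) 1) with hTdef
  refine ⟨c₁, hc₁, by rw [hc₁def]; linarith, T, fun n hn hT S hS hgap r hr => ?_⟩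
  -- notation
  set N : ℕ := 2 ^ n with hNdef
  have hNR : ((N : ℕ) : ℝ) = (2 : ℝ) ^ n := by rw [hNdef]; push_cast; ring
  have hN2 : 2 ≤ N := by
    rw [hNdef]
    calc 2 = 2 ^ 1 := (pow_one 2).symm
      _ ≤ 2 ^ n := Nat.pow_le_pow_right two_pos (by omega)
  have hN0 : (0 : ℝ) < N := by positivity
  set L : ℝ := Real.log ((2 : ℝ) ^ n) with hLdef
  have hLN : Real.log (N : ℝ) = L := by rw [hNR]
  set u : ℝ := Real.sqrt L with hudef
  have hT1 : (1000 / c₄) ^ 2 ≤ u := le_trans (le_trans (le_max_left _ _) (le_max_left _ _)) hT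
  have hT2 : 5 * Real.log (CI + 1) / c₄ ≤ u :=
    le_trans (le_trans (le_max_right _ _) (le_max_left _ _)) hT
  have hT3 : 2 * Real.log (C₄ + 1) / c₄ ≤ u :=
    le_trans (le_trans (le_max_left _ _) (le_max_right _ _)) hT
  have hu1 : 1 ≤ u := le_trans (le_trans (le_max_right _ _) (le_max_right _ _)) hT
  have hu0 : 0 < u := by linarith
  have hL1 : 1 ≤ L := by
    have h := Real.sq_sqrt (Real.log_nonneg (one_le_pow₀ (by norm_num : (1 : ℝ) ≤ 2)) : 0 ≤ L)
    rw [← hudef] at h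
    nlinarith
  -- the three largeness facts
  have hpoly : (1 + L) ^ (40 : ℕ) ≤ Real.exp (c₄ / 5 * u) := one_add_pow_forty_le_exp hc₄ hc₄1 hL1 hT1
  have hCI' : CI + 1 ≤ Real.exp (c₄ / 5 * u) := by
    have h1 : Real.log (CI + 1) ≤ c₄ / 5 * u := by
      rw [div_le_iff₀ hc₄] at hT2; linarith
    calc CI + 1 = Real.exp (Real.log (CI + 1)) := (Real.exp_log (by linarith)).symm
      _ ≤ Real.exp (c₄ / 5 * u) := Real.exp_le_exp.2 h1
  have hC₄' : C₄ + 1 ≤ Real.exp (c₄ / 2 * u) := by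
    have h1 : Real.log (C₄ + 1) ≤ c₄ / 2 * u := by
      rw [div_le_iff₀ hc₄] at hT3; linarith
    calc C₄ + 1 = Real.exp (Real.log (C₄ + 1)) := (Real.exp_log (by linarith)).symm
      _ ≤ Real.exp (c₄ / 2 * u) := Real.exp_le_exp.2 h1
  -- suppose the sum is large
  by_contra hcon
  push Not at hcon
  set θ : ℝ := ∑ j ∈ S, (r j : ℝ) / 2 ^ ((j : ℕ) + 1) with hθdef
  set δ₁ : ℝ := Real.exp (-(c₁ * u)) with hδ₁def
  have hδ₁0 : 0 < δ₁ := Real.exp_pos _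
  have hS_eq : ∑ x ∈ range (2 ^ n), (((μ x : ℤ) : ℝ) : ℂ) * (𝐞 (θ * x) : ℂ) =
      afExpSum (fun m => (μ m : ℝ)) N θ := sum_range_moebius_eq_afExpSum hn θ
  have hbigC : δ₁ * N ≤ ‖afExpSum (fun m => (μ m : ℝ)) N θ‖ := by
    rw [← hS_eq, hNR]; exact hcon
  -- Proposition 4
  obtain ⟨q₀, a₀, hq₀1, hq₀Q, hθ₀⟩ := hC N hN2 θ δ₁ hδ₁0 hbigC
  set Q : ℝ := CI * ((1 + Real.log N) / δ₁) ^ 40 with hQdef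
  have hQ' : Q ≤ Real.exp (3 * c₄ / 5 * u) := by
    rw [hQdef, hLN, div_pow]
    have h1 : δ₁ ^ 40 = Real.exp (-(c₄ / 5 * u)) := by
      rw [hδ₁def, ← Real.exp_nat_mul, hc₁def]; congr 1; ring
    have h2 : (1 + L) ^ 40 / δ₁ ^ 40 ≤ Real.exp (c₄ / 5 * u) * Real.exp (c₄ / 5 * u) := by
      rw [h1, Real.exp_neg, div_inv_eq_mul]
      exact mul_le_mul_of_nonneg_right hpoly (Real.exp_pos _).le
    have h3 : Real.exp (3 * c₄ / 5 * u) =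
        Real.exp (c₄ / 5 * u) * (Real.exp (c₄ / 5 * u) * Real.exp (c₄ / 5 * u)) := by
      rw [← Real.exp_add, ← Real.exp_add]; congr 1; ring
    rw [h3]
    refine mul_le_mul (by linarith) h2 (by positivity) (Real.exp_pos _).le
  set Q' : ℝ := Real.exp (3 * c₄ / 5 * u) with hQ'def
  have hQ'1 : 1 ≤ Q' := Real.one_le_exp (by positivity)
  -- lowest terms
  obtain ⟨q, a, hq1, hqq₀, hcop, haq⟩ := exists_coprime_eq_div a₀ hq₀1
  have hqQ' : (q : ℝ) ≤ Q' := by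
    calc (q : ℝ) ≤ q₀ := by exact_mod_cast hqq₀
      _ ≤ Q := hq₀Q
      _ ≤ Q' := hQ'
  -- Lemma 1 (Harman–Kátai)
  set k : ℕ := S.card with hkdef
  set i' : Fin k → ℕ := fun j => (((S.equivFin.symm j : S) : Fin n) : ℕ) + 1 with hi'def
  set r' : Fin k → ℤ := fun j => r ((S.equivFin.symm j : S) : Fin n) with hr'def
  have hi' : Function.Injective i' := injective_enum_succ S
  have hθsum : ∑ j, (r' j : ℝ) / 2 ^ (i' j) = θ :=
    sum_enum_eq S (fun i : Fin n => (r i : ℝ) / 2 ^ ((i : ℕ) + 1))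
  have hr' : ∀ j, |(r' j : ℝ)| ≤ Q' := by
    intro j
    refine (hr _).trans (Real.exp_le_exp.2 ?_)
    rw [hc₁def]
    nlinarith
  have hθ' : |∑ j, (r' j : ℝ) / 2 ^ (i' j) - a / q| ≤ Q' / 2 ^ n := by
    rw [hθsum, haq, ← hNR]
    refine hθ₀.trans (div_le_div_of_nonneg_right ?_ hN0.le)
    exact hQ'
  have hkg : (k + 1) * (n / (k + 1)) ≤ n := Nat.mul_div_le n (k + 1)
  have hgap' : 4 * Q' ^ 2 < (2 : ℝ) ^ (n / (k + 1)) := by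
    refine lt_of_le_of_lt ?_ hgap
    rw [hQ'def, ← Real.exp_nat_mul]
    refine mul_le_mul_of_nonneg_left (Real.exp_le_exp.2 ?_) (by norm_num)
    push_cast
    have : c₄ * u ≤ 1 * u := mul_le_mul_of_nonneg_right hc₄1 hu0.le
    linarith
  obtain ⟨t, ht⟩ := twoPower_of_sparseDyadic_near i' hi' r' hr' hq1 hqQ' hcop hθ' hkg hgap'
  -- Corollary 2 (major arcs at 2-power moduli)
  have hQ'c₄ : Q' ≤ Real.exp (c₄ * Real.sqrt (Real.log N)) := by
    rw [hLN, ← hudef]; exact Real.exp_le_exp.2 (by nlinarith)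
  have h2t : (2 : ℝ) ^ t ≤ Real.exp (c₄ * Real.sqrt (Real.log N)) := by
    have : (2 : ℝ) ^ t = q := by rw [ht]; push_cast; ring
    rw [this]; exact hqQ'.trans hQ'c₄
  have hnear : |θ - (a : ℝ) / 2 ^ t| ≤ Real.exp (c₄ * Real.sqrt (Real.log N)) / N := by
    have : (a : ℝ) / 2 ^ t = a₀ / q₀ := by
      rw [← haq, ht]; push_cast; ring
    rw [this]
    refine hθ₀.trans (div_le_div_of_nonneg_right (hQ'.trans hQ'c₄) hN0.le)
  have hBapp := hB N hN2 t h2t a θ hnear N le_rfl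
  -- contradiction
  rw [hLN, ← hudef] at hBapp
  have h1 : δ₁ * N ≤ C₄ * N * Real.exp (-(c₄ * u)) := hbigC.trans hBapp
  have h2 : δ₁ ≤ C₄ * Real.exp (-(c₄ * u)) := by
    have := div_le_div_of_nonneg_right h1 hN0.le
    rwa [mul_div_cancel_right₀ _ hN0.ne', mul_assoc, mul_comm (N : ℝ), ← mul_assoc,
      mul_div_cancel_right₀ _ hN0.ne'] at this
  -- `exp((c₄ − c₁)u) ≤ C₄ < C₄ + 1 ≤ exp((c₄/2) u)`
  have h3 : Real.exp ((c₄ - c₁) * u) ≤ C₄ := by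
    have e : Real.exp ((c₄ - c₁) * u) = δ₁ * Real.exp (c₄ * u) := by
      rw [hδ₁def, ← Real.exp_add]; congr 1; ring
    rw [e]
    calc δ₁ * Real.exp (c₄ * u) ≤ C₄ * Real.exp (-(c₄ * u)) * Real.exp (c₄ * u) :=
          mul_le_mul_of_nonneg_right h2 (Real.exp_pos _).le
      _ = C₄ := by rw [mul_assoc, ← Real.exp_add, neg_add_cancel, Real.exp_zero, mul_one]
  have h4 : Real.exp ((c₄ - c₁) * u) < Real.exp (c₄ / 2 * u) := by linarith
  rw [Real.exp_lt_exp] at h4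
  rw [hc₁def] at h4
  nlinarith

/-! ### Green's Proposition 1 for `μ` -/

/-- `√(log 2) ∈ [1/2, 1]`. [folklore] -/
theorem sqrt_log_two_bounds : 1 / 2 ≤ Real.sqrt (Real.log 2) ∧ Real.sqrt (Real.log 2) ≤ 1 := by
  have h1 := Real.log_two_gt_d9
  have h2 := Real.log_two_lt_d9
  constructor
  · rw [Real.le_sqrt (by norm_num) (by linarith)]; nlinarith
  · rw [Real.sqrt_le_one]; linarith

/-- `log 578 ≤ 7`. [folklore] -/
theorem log_578_le : Real.log 578 ≤ 7 := by
  rw [Real.log_le_iff_le_exp (by norm_num)]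
  have h1 := Real.exp_one_gt_d9
  have h7 : Real.exp 7 = Real.exp 1 ^ 7 := by rw [← Real.exp_nat_mul]; norm_num
  rw [h7]
  have h2 : (2.7 : ℝ) ≤ Real.exp 1 := by linarith
  calc (578 : ℝ) ≤ 2.7 ^ 7 := by norm_num
    _ ≤ Real.exp 1 ^ 7 := pow_le_pow_left₀ (by norm_num) h2 7

/-- The gap hypothesis of `prop3` from `20k < √n`: `4 e^{2√(log 2ⁿ)} < 2^{⌊n/(k+1)⌋}`. [folklore] -/
theorem gap_of_small_card {n k : ℕ} (hk : 1 ≤ k) (hkn : 20 * (k : ℝ) < Real.sqrt n) :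
    4 * Real.exp (2 * Real.sqrt (Real.log ((2 : ℝ) ^ n))) < (2 : ℝ) ^ (n / (k + 1)) := by
  obtain ⟨hs1, hs2⟩ := sqrt_log_two_bounds
  have hlog2 := Real.log_two_gt_d9
  have hlog2' := Real.log_two_lt_d9
  have hk0 : (0 : ℝ) < k := by exact_mod_cast hk
  have hk1 : (1 : ℝ) ≤ k := by exact_mod_cast hk
  have hn0 : (0 : ℝ) ≤ n := Nat.cast_nonneg n
  have hsn : 20 < Real.sqrt n := lt_of_le_of_lt (by linarith) hkn
  have hsqn : Real.sqrt n * Real.sqrt n = n := Real.mul_self_sqrt hn0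
  set m : ℕ := n / (k + 1) with hmdef
  -- `m > n/(k+1) − 1 ≥ n/(2k) − 1 > 10√n − 1`
  have hm : (n : ℝ) / (k + 1) - 1 < m := by
    have h1 : n < (k + 1) * (m + 1) := Nat.lt_mul_div_succ n (by omega)
    have h2 : (n : ℝ) < ((k : ℝ) + 1) * ((m : ℝ) + 1) := by exact_mod_cast h1
    rw [sub_lt_iff_lt_add, div_lt_iff₀ (by positivity)]
    linarith
  have h2k : (n : ℝ) / (2 * k) ≤ n / (k + 1) :=
    div_le_div_of_nonneg_left hn0 (by positivity) (by linarith)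
  have h3 : 10 * Real.sqrt n < (n : ℝ) / (2 * k) := by
    rw [lt_div_iff₀ (by positivity)]
    calc 10 * Real.sqrt n * (2 * k) = (20 * k) * Real.sqrt n := by ring
      _ < Real.sqrt n * Real.sqrt n := mul_lt_mul_of_pos_right hkn (by linarith)
      _ = n := hsqn
  have hm' : 10 * Real.sqrt n - 1 < m := by linarith
  -- `2^m = e^{m log 2}` and `4 e^{2√L} = e^{log 4 + 2 √(log 2) √n}`
  have hL : Real.sqrt (Real.log ((2 : ℝ) ^ n)) = Real.sqrt (Real.log 2) * Real.sqrt n := by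
    rw [Real.log_pow, mul_comm, Real.sqrt_mul (Real.log_nonneg one_le_two)]
  have h2m : (2 : ℝ) ^ m = Real.exp (m * Real.log 2) := by
    rw [Real.exp_nat_mul, Real.exp_log two_pos]
  have h4 : (4 : ℝ) * Real.exp (2 * Real.sqrt (Real.log ((2 : ℝ) ^ n))) =
      Real.exp (Real.log 4 + 2 * (Real.sqrt (Real.log 2) * Real.sqrt n)) := by
    rw [Real.exp_add, Real.exp_log (by norm_num), hL]
  rw [h4, h2m, Real.exp_lt_exp]
  have hlog4 : Real.log 4 = 2 * Real.log 2 := by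
    rw [show (4 : ℝ) = 2 ^ 2 by norm_num, Real.log_pow]; norm_num
  rw [hlog4]
  have h5 : (10 * Real.sqrt n - 1) * Real.log 2 < m * Real.log 2 :=
    mul_lt_mul_of_pos_right hm' (Real.log_pos one_lt_two)
  nlinarith [Real.sqrt_nonneg (n : ℝ)]

open Literature.Computability.Complexity.LowDegree (abs_cubeFourierCoeff_le_one) in
set_option maxHeartbeats 800000 in
/-- **Green 2012, Proposition 1 for the Möbius function**, in the vendored form
`Literature.Computability.Complexity.Green2012_moebius_walshCoeff`: there are absolute `c > 0`, `C`
such that for all `n` and all `S ⊆ {0,…,n−1}` with `|S| = k ≥ 1`,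
`|μ̂(S)| = |2^{-n} Σ_{x∈{0,1}ⁿ} μ(val x)(−1)^{Σ_{i∈S}x_i}| ≤ C k e^{−c√n/k}`. Proof as printed
(Proposition 2 = `WalshDyadic.exists_sparse_dyadic_of_le_abs_cubeFourierCoeff` and Proposition 3 =
`prop3` are incompatible for
`|μ̂(S)| ≥ Cke^{−c√n/k}` when this quantity is `< 1`; otherwise `|μ̂(S)| ≤ 1` suffices).
[cite: Green2012, Proposition 1 (proof, end of §3)] -/
theorem prop1 : Green2012_moebius_walshCoeff := by
  obtain ⟨c₁, hc₁, hc₁1, T, hP3⟩ := prop3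
  obtain ⟨hs2, hs1⟩ := sqrt_log_two_bounds
  set s : ℝ := Real.sqrt (Real.log 2) with hsdef
  have hs0 : 0 < s := by linarith
  set c : ℝ := c₁ * s / 40 with hcdef
  have hc0 : 0 < c := by positivity
  have hc1 : c ≤ 1 := by
    rw [hcdef]; nlinarith
  have hlogc : 0 ≤ Real.log (1 / c) := Real.log_nonneg (by rw [le_div_iff₀ hc0]; linarith)
  set B : ℝ := 3 + 20 * c + 2 * c * max T 0 + 2 * Real.log (1 / c) with hBdef
  have hmax0 : 0 ≤ max T 0 := le_max_right _ _
  have hB1 : 1 ≤ B := by rw [hBdef]; nlinarith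
  have hB20 : 20 * c ≤ B := by rw [hBdef]; nlinarith
  have hBT : 2 * c * T ≤ B := by
    have : T ≤ max T 0 := le_max_left _ _
    rw [hBdef]; nlinarith
  have hBc : 2 * Real.log (1 / c) + 2 ≤ B := by rw [hBdef]; nlinarith
  refine ⟨c, hc0, Real.exp B, fun n S hS => ?_⟩
  set k : ℕ := S.card with hkdef
  have hk0 : (0 : ℝ) < k := by exact_mod_cast hS
  have hk1 : (1 : ℝ) ≤ k := by exact_mod_cast hS
  have hSne : S.Nonempty := Finset.card_pos.1 hS
  set μhat : ℝ := cubeFourierCoeff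
    (fun x : Fin n → Bool => (ArithmeticFunction.moebius (bitsToNat (List.ofFn x)) : ℝ)) S with hμhat
  have hμ1 : |μhat| ≤ 1 :=
    abs_cubeFourierCoeff_le_one _ (fun x => by exact_mod_cast ArithmeticFunction.abs_moebius_le_one) S
  set δ : ℝ := Real.exp B * k * Real.exp (-(c * Real.sqrt n / k)) with hδdef
  have hδ0 : 0 < δ := by positivity
  show |μhat| ≤ δ
  by_cases hδ1 : 1 ≤ δ
  · exact hμ1.trans hδ1
  push Not at hδ1
  by_contra hcon
  push Not at hcon
  -- (F1): `ρ = c√n/k > B`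
  set ρ : ℝ := c * Real.sqrt n / k with hρdef
  have hlogδ : Real.log δ = B + Real.log k - ρ := by
    have h1 : Real.exp B * k ≠ 0 := by positivity
    rw [hδdef, Real.log_mul h1 (Real.exp_pos _).ne', Real.log_mul (Real.exp_pos _).ne' hk0.ne',
      Real.log_exp, Real.log_exp]
    ring
  have hlogδneg : Real.log δ < 0 := Real.log_neg hδ0 hδ1
  have hlogk : 0 ≤ Real.log k := Real.log_nonneg hk1
  have hρB : B < ρ := by linarith
  have hρ0 : 0 < ρ := by linarith
  have hcn : c * Real.sqrt n = k * ρ := by rw [hρdef]; field_simp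
  have hρcn : ρ ≤ c * Real.sqrt n := by
    rw [hcn]; exact le_mul_of_one_le_left hρ0.le hk1
  have hkB : k * B < c * Real.sqrt n := by rw [hcn]; exact mul_lt_mul_of_pos_left hρB hk0
  have hcnB : B < c * Real.sqrt n := lt_of_lt_of_le hρB hρcn
  have hkc : (k : ℝ) < c * Real.sqrt n := by
    calc (k : ℝ) = k * 1 := (mul_one _).symm
      _ ≤ k * B := mul_le_mul_of_nonneg_left hB1 hk0.le
      _ < c * Real.sqrt n := hkB
  -- `√n > 20k ≥ 20`, so `n ≥ 2`
  have hkn : 20 * (k : ℝ) < Real.sqrt n := by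
    have h1 : 20 * c * k ≤ k * B := by nlinarith
    have h2 : 20 * c * k < c * Real.sqrt n := lt_of_le_of_lt h1 hkB
    nlinarith
  have hsn : 20 < Real.sqrt n := lt_of_le_of_lt (by nlinarith) hkn
  have hn0 : (0 : ℝ) ≤ n := Nat.cast_nonneg n
  have hn2 : 2 ≤ n := by
    by_contra h
    push Not at h
    have h1 : (n : ℝ) ≤ 1 := by exact_mod_cast Nat.lt_succ_iff.mp h
    have h2 : Real.sqrt n ≤ 1 := Real.sqrt_le_one.mpr h1
    linarith
  -- `√L = s √n`
  have hsqrtL : Real.sqrt (Real.log ((2 : ℝ) ^ n)) = s * Real.sqrt n := by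
    rw [Real.log_pow, mul_comm, Real.sqrt_mul (Real.log_nonneg one_le_two), hsdef]
  -- (H2)
  have hT : T ≤ Real.sqrt (Real.log ((2 : ℝ) ^ n)) := by
    rw [hsqrtL]
    have h1 : 2 * c * T < 2 * c * (s * Real.sqrt n) := by
      calc 2 * c * T ≤ B := hBT
        _ < c * Real.sqrt n := hcnB
        _ ≤ 2 * c * (s * Real.sqrt n) := by nlinarith [Real.sqrt_nonneg (n : ℝ)]
    exact (lt_of_mul_lt_mul_left h1 (by positivity)).le
  -- (H3)
  have hgap := gap_of_small_card hS hkn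
  -- Proposition 2 (Kátai), with `R = ⌈4k(n+1)/δ⌉ + 1`
  have h2n : (0 : ℝ) < 2 ^ n := pow_pos two_pos n
  have hn1 : (1 : ℝ) ≤ n := by exact_mod_cast (show 1 ≤ n by omega)
  set R : ℕ := ⌈4 * (k : ℝ) * (n + 1) / δ⌉₊ + 1 with hRdef
  have hR1 : 1 ≤ R := Nat.le_add_left 1 _
  have hRr : (1 : ℝ) ≤ R := by exact_mod_cast hR1
  have hR0 : (0 : ℝ) < R := by linarith
  have hRδ : 4 * (S.card : ℝ) * (n + 1) ≤ δ * R := by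
    rw [← hkdef]
    have h1 : 4 * (k : ℝ) * (n + 1) / δ ≤ R := by
      rw [hRdef]; push_cast
      exact (Nat.le_ceil _).trans (by linarith)
    rw [div_le_iff₀ hδ0] at h1
    rw [mul_comm δ]
    exact h1
  obtain ⟨r, hr0, hrR, hη⟩ := exists_sparse_dyadic_of_le_abs_cubeFourierCoeff
    (fun m => ((ArithmeticFunction.moebius m : ℤ) : ℝ))
    (fun m => by exact_mod_cast ArithmeticFunction.abs_moebius_le_one) S hδ0 hcon.le hR1 hRδ
  set W : ℝ := 2 * (R : ℝ) with hWdef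
  have hW1 : 1 ≤ W := by rw [hWdef]; linarith
  have hW0 : 0 < W := by linarith
  have hRW : (R : ℝ) ≤ W := by rw [hWdef]; linarith
  -- `log n = 2 log √n = 2 log (kρ/c) ≤ 2 log k + 2ρ + 2 log(1/c)`
  have hsqrtn0 : 0 < Real.sqrt n := by linarith
  have hlogn : Real.log n ≤ 2 * Real.log k + 2 * ρ + 2 * Real.log (1 / c) := by
    have h1 : Real.log n = 2 * Real.log (Real.sqrt n) := by
      rw [Real.log_sqrt hn0]; ring
    have h2 : Real.sqrt n = k * ρ * (1 / c) := by
      field_simp; linarith [hcn]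
    have h3 : Real.log (Real.sqrt n) = Real.log k + Real.log ρ + Real.log (1 / c) := by
      rw [h2, Real.log_mul (mul_ne_zero hk0.ne' hρ0.ne') (one_div_pos.2 hc0).ne',
        Real.log_mul hk0.ne' hρ0.ne']
    have h4 : Real.log ρ ≤ ρ := (Real.log_le_sub_one_of_pos hρ0).trans (by linarith)
    rw [h1, h3]; linarith
  -- `log W ≤ 3 + log n + ρ − B`
  have hkδ : 1 ≤ (k : ℝ) / δ := by rw [le_div_iff₀ hδ0]; linarith
  have hWle : W ≤ 20 * ((k : ℝ) / δ) * n := by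
    have h1 : (R : ℝ) ≤ 4 * (k : ℝ) * (n + 1) / δ + 2 := by
      rw [hRdef]; push_cast
      have := Nat.ceil_lt_add_one (show 0 ≤ 4 * (k : ℝ) * (n + 1) / δ by
        exact div_nonneg (by nlinarith) hδ0.le)
      linarith
    have h2 : 4 * (k : ℝ) * (n + 1) / δ ≤ 8 * ((k : ℝ) / δ) * n := by
      rw [div_le_iff₀ hδ0]
      have e : 8 * ((k : ℝ) / δ) * n * δ = 8 * k * n := by field_simp
      rw [e]; nlinarith
    have h3 : (2 : ℝ) ≤ 2 * ((k : ℝ) / δ) * n := by nlinarith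
    rw [hWdef]; linarith
  have hlogW : Real.log W ≤ 7 + Real.log n + ρ - B := by
    have hkδ0 : 0 < (k : ℝ) / δ := by linarith
    have h1 : Real.log W ≤ Real.log 20 + Real.log ((k : ℝ) / δ) + Real.log n := by
      calc Real.log W ≤ Real.log (20 * ((k : ℝ) / δ) * n) := Real.log_le_log hW0 hWle
        _ = Real.log 20 + Real.log ((k : ℝ) / δ) + Real.log n := by
            have h20 : (20 : ℝ) ≠ 0 := by norm_num
            rw [Real.log_mul (mul_ne_zero h20 hkδ0.ne') (by linarith), Real.log_mul h20 hkδ0.ne']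
    have h2 : Real.log ((k : ℝ) / δ) = Real.log k - Real.log δ := Real.log_div hk0.ne' hδ0.ne'
    have h3 : Real.log 20 ≤ 7 := (Real.log_le_log (by norm_num) (by norm_num)).trans log_578_le
    rw [h2, hlogδ] at h1
    linarith
  have hlogW0 : 0 ≤ Real.log W := Real.log_nonneg hW1
  -- (H4): the numerators are `≤ e^{c₁√L} = e^{40 c √n}`
  have hc₁L : c₁ * Real.sqrt (Real.log ((2 : ℝ) ^ n)) = 40 * c * Real.sqrt n := by
    rw [hsqrtL, hcdef]; ring
  have hklogk : (k : ℝ) * Real.log k < c * Real.sqrt n := by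
    have h3 : (k : ℝ) * (B + Real.log k) < k * ρ := mul_lt_mul_of_pos_left (by linarith) hk0
    rw [← hcn] at h3
    have e : (k : ℝ) * (B + Real.log k) = k * B + k * Real.log k := by ring
    rw [e] at h3
    have : 0 ≤ (k : ℝ) * B := mul_nonneg hk0.le (by linarith)
    linarith
  have hlogk' : Real.log k < c * Real.sqrt n := by
    have h1 : Real.log k ≤ k * Real.log k := le_mul_of_one_le_left hlogk hk1
    linarith
  have hlogc' : Real.log (1 / c) < c * Real.sqrt n := by linarith
  have h7 : (7 : ℝ) < 7 * (c * Real.sqrt n) := by linarith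
  have hlogW' : Real.log W ≤ 40 * c * Real.sqrt n := by linarith
  have hWexp : W ≤ Real.exp (40 * c * Real.sqrt n) := by
    calc W = Real.exp (Real.log W) := (Real.exp_log hW0).symm
      _ ≤ Real.exp (40 * c * Real.sqrt n) := Real.exp_le_exp.2 hlogW'
  have hr : ∀ i, |(r i : ℝ)| ≤ Real.exp (c₁ * Real.sqrt (Real.log ((2 : ℝ) ^ n))) := by
    intro i
    rw [hc₁L]
    have h1 : |(r i : ℝ)| ≤ R := by
      have h2 := (hrR i).le
      have h3 : ((|r i| : ℤ) : ℝ) ≤ ((R : ℤ) : ℝ) := by exact_mod_cast h2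
      rw [Int.cast_abs] at h3
      exact_mod_cast h3
    exact h1.trans (hRW.trans hWexp)
  -- Proposition 3
  have hP := hP3 n hn2 hT S hSne hgap r hr
  rw [hc₁L] at hP
  have hsums : ∑ x ∈ range (2 ^ n), (((μ x : ℤ) : ℝ) : ℂ) *
      (𝐞 ((∑ j ∈ S, (r j : ℝ) / 2 ^ ((j : ℕ) + 1)) * x) : ℂ) =
      ∑ m ∈ range (2 ^ n), ((((ArithmeticFunction.moebius m : ℤ) : ℝ) : ℝ) : ℂ) *
        (𝐞 ((m : ℝ) * ∑ i ∈ S, (r i : ℝ) / (2 : ℝ) ^ ((i : ℕ) + 1)) : ℂ) := by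
    refine Finset.sum_congr rfl fun x _ => ?_
    rw [mul_comm (∑ j ∈ S, (r j : ℝ) / 2 ^ ((j : ℕ) + 1)) (x : ℝ)]
  rw [hsums] at hP
  have h1 : δ / (2 * W ^ S.card) * 2 ^ n < Real.exp (-(40 * c * Real.sqrt n)) * 2 ^ n := by
    have h2 : δ / (2 * W ^ S.card) = δ / (2 * (2 * (R : ℝ)) ^ S.card) := by rw [hWdef]
    rw [h2]
    exact lt_of_le_of_lt hη hP
  have hη' : δ / (2 * W ^ k) < Real.exp (-(40 * c * Real.sqrt n)) := by
    rw [hkdef]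
    exact lt_of_mul_lt_mul_right h1 h2n.le
  -- take logarithms
  have hlogdiv : ∀ d : ℝ, 0 < d →
      Real.log (d / (2 * W ^ k)) = Real.log d - Real.log 2 - k * Real.log W := by
    intro d hd
    have h2 : (2 : ℝ) ≠ 0 := by norm_num
    have hWk : (W ^ k) ≠ 0 := pow_ne_zero _ hW0.ne'
    have h2Wk : (2 * W ^ k) ≠ 0 := mul_ne_zero h2 hWk
    rw [Real.log_div hd.ne' h2Wk, Real.log_mul h2 hWk, Real.log_pow]
    ring
  have hlog : Real.log δ - Real.log 2 - k * Real.log W < -(40 * c * Real.sqrt n) := by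
    have hpos : (0 : ℝ) < δ / (2 * W ^ k) := div_pos hδ0 (mul_pos (by norm_num) (pow_pos hW0 _))
    have h1 := Real.log_lt_log hpos hη'
    rw [Real.log_exp, hlogdiv δ hδ0] at h1
    exact h1
  have hlog2 : Real.log 2 ≤ 1 := by
    have := Real.log_two_lt_d9; linarith
  -- `k log W ≤ 7k + k log n + kρ − kB ≤ 7k + 2k log k + 3 c√n + (2k log(1/c) − kB) ≤ 12 c√n`
  have hkW : (k : ℝ) * Real.log W ≤ 12 * (c * Real.sqrt n) := by
    have h1 : (k : ℝ) * Real.log W ≤ 7 * k + k * Real.log n + k * ρ - k * B := by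
      calc (k : ℝ) * Real.log W ≤ k * (7 + Real.log n + ρ - B) :=
            mul_le_mul_of_nonneg_left hlogW hk0.le
        _ = 7 * k + k * Real.log n + k * ρ - k * B := by ring
    have h2 : (k : ℝ) * Real.log n ≤
        2 * (k * Real.log k) + 2 * (k * ρ) + 2 * (k * Real.log (1 / c)) := by
      calc (k : ℝ) * Real.log n ≤ k * (2 * Real.log k + 2 * ρ + 2 * Real.log (1 / c)) :=
            mul_le_mul_of_nonneg_left hlogn hk0.le
        _ = 2 * (k * Real.log k) + 2 * (k * ρ) + 2 * (k * Real.log (1 / c)) := by ring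
    have h3 : 2 * ((k : ℝ) * Real.log (1 / c)) ≤ k * B := by
      calc 2 * ((k : ℝ) * Real.log (1 / c)) = k * (2 * Real.log (1 / c)) := by ring
        _ ≤ k * B := mul_le_mul_of_nonneg_left (by linarith) hk0.le
    have h4 : (k : ℝ) * ρ = c * Real.sqrt n := hcn.symm
    linarith
  -- `log δ − log 2 − k log W ≥ (B + log k − ρ) − 1 − 12c√n > −14 c√n`
  have hfin : -(14 * (c * Real.sqrt n)) < Real.log δ - Real.log 2 - k * Real.log W := by
    rw [hlogδ]
    linarith
  linarith

end Green2012Walsh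

/-- **Green 2012, Proposition 1 for `μ`, discharged**: the named fact
`Literature.Computability.Complexity.Green2012_moebius_walshCoeff` holds. [cite: Green2012, Proposition 1] -/
theorem Green2012_moebius_walshCoeff_holds : Green2012_moebius_walshCoeff := Green2012Walsh.prop1

/-- **Green 2012, Proposition 1 for `μ` in the `LFunctions` vocabulary**: the twin named fact
`Literature.NumberTheory.LFunctions.green_moebius_fourierWalsh` holds as well, by the proved bridge
`Green2012_moebius_walshCoeff_iff`. [cite: Green2012, Proposition 1] -/
theorem green_moebius_fourierWalsh_holds :
    Literature.NumberTheory.LFunctions.green_moebius_fourierWalsh :=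
  Green2012_moebius_walshCoeff_iff.1 Green2012_moebius_walshCoeff_holds

end Literature.Computability.Complexity
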